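import Summits.Ventures.LatticeQCDFlow.TrivializingMaps.SpecificHeatCeilingTwoDim

/-!
HONEST FRAMING: exact (Metropolis-corrected) sampling algorithms for lattice gauge theory; figures
of merit are autocorrelation/cost numbers at stated couplings and volumes; no continuum-physics
claim.

# MeanActionTwoDim — IN TWO DIMENSIONS THE MEAN WILSON ACTION IS THE ONE-PLAQUETTE VALUE UP TO `O(L)`:
# `|⟨S_W⟩_β − (L² − 1)·⟨s⟩_{1,β}| ≤ N·√(L² − 1)·(e^{2N|β|} − 1) + 2N` on `(ℤ/L)²`, `L ≥ 2`, every real `β`,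
# every compact gauge group — the mean plaquette of the finite torus equals the one-plaquette (infinite-volume)
# mean plaquette up to `O(e^{2N|β|}N/L)` (lean-2 GEN-12, ours)

Venture-side (OURS).  Cell `lqcd-flow` (pub-lqcd), unit `pub-lqcd-lean-2-g12`, 2026-08-23.  A first-moment
companion of `SpecificHeatCeilingTwoDim`: with the puncture `x₀`, the punctured measure `ν_β` (under which the
`L² − 1` off-puncture plaquettes are i.i.d. with the one-plaquette tilted Haar law `π_β = Haar.tilted(−βs)`,
`s = N − Re tr ρ`) and `μ_β = ν_β.tilted(−βs(U_{x₀}))` (oscillation `2N|β|`):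
(i) a tilt by a potential of oscillation `2K` moves the mean of an observable `X` by at most
`(e^{2K} − 1)·√Var(X)` (`abs_integral_tilted_sub_integral_le`); (ii) `E_{ν_β}[S'] = (L² − 1)·⟨s⟩_{π_β}` and
`Var_{ν_β}(S') ≤ (L² − 1)N²` (`SpecificHeatCeilingTwoDim.variance_punctured_le`); (iii) `S_W = S' + s(U_{x₀})`
with `0 ≤ s ≤ 2N`.

* `abs_integral_tilted_sub_integral_le` (general): `|∫X d(μ.tilted h) − ∫X dμ| ≤ (e^{2K} − 1)·√Var_μ(X)` for
  `|h − c| ≤ K`, `X` bounded measurable;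
* `integral_punctured_eq` — `E_{ν_β}[S'] = (L² − 1)·∫ s dπ_β`;
* **`wilson_meanAction_twoDim`** — `|⟨S_W⟩_β − (L² − 1)·∫ s dπ_β| ≤ N·√(L² − 1)·(e^{2N|β|} − 1) + 2N`.

Reading (no numerics implied): for every compact gauge group the finite-torus mean plaquette in two dimensions
differs from the single-plaquette (Gross–Witten / Bessel-ratio) value `∫ s dπ_β` per plaquette by
`O(N e^{2N|β|}/L)`, uniformly — the cell's infinite-volume one-plaquette oracles are the finite-volume truth
up to this explicit finite-size term (for `U(1)`, `SU(2)`, `SU(3)` row 5 has the EXACT torus formulas; this is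
the every-`G` structural form).  NOT CLAIMED: `d ≥ 3`; the sharp finite-size rate (exponentially small in `L²`
for `U(1)` by row 5); the continuum.  Literature grade: KNOWN MECHANISM (Migdal 1975 / Gross–Witten 1980),
NEW TYPING; nothing is cited as a fact.
-/

noncomputable section

open MeasureTheory ProbabilityTheory Real Set
open Literature.MathematicalPhysics.QuantumFieldTheory
open Literature.MathematicalPhysics.QuantumFieldTheory.Luscher2010
open Summit.Ventures.LatticeQCDFlow.Scaling
open Summit.Ventures.LatticeQCDFlow.Theory2.Lattice.TwoDim
open Literature.Probability.LatticeModels (integrable_of_continuous_compactSpace)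

namespace Summit.Ventures.LatticeQCDFlow.TrivializingMaps

/-! ## §1 A bounded-oscillation tilt moves means by at most `(e^{2K} − 1)·√Var` -/

section Tilted

variable {α : Type*} [MeasurableSpace α]

/-- `(∫ |Y| dμ)² ≤ ∫ Y² dμ` on a probability space (variance of `|Y|` is nonnegative). [folklore] -/
theorem sq_integral_abs_le_integral_sq {μ : Measure α} [IsProbabilityMeasure μ] {Y : α → ℝ}
    (hYm : Measurable Y) {C : ℝ} (hYb : ∀ x, |Y x| ≤ C) :
    (∫ x, |Y x| ∂μ) ^ 2 ≤ ∫ x, Y x ^ 2 ∂μ := by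
  have hmem : MemLp (fun x => |Y x|) 2 μ :=
    MemLp.of_bound hYm.abs.aestronglyMeasurable C (ae_of_all _ fun x => by
      rw [Real.norm_eq_abs, abs_abs]; exact hYb x)
  have hv := variance_nonneg (fun x => |Y x|) μ
  rw [variance_eq_sub hmem] at hv
  have e : ∫ x, ((fun x => |Y x|) ^ 2) x ∂μ = ∫ x, Y x ^ 2 ∂μ :=
    integral_congr_ae (ae_of_all _ fun x => by simp only [Pi.pow_apply, sq_abs])
  rw [e] at hv
  have e2 : μ[fun x => |Y x|] = ∫ x, |Y x| ∂μ := rfl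
  linarith

/-- **A tilt of oscillation `2K` moves the mean of a bounded observable by at most `(e^{2K} − 1)·√Var`**:
for `|h − c| ≤ K` and bounded measurable `X` on a probability space,
`|∫ X d(μ.tilted h) − ∫ X dμ| ≤ (e^{2K} − 1)·√(Var_μ X)`. [folklore] -/
theorem abs_integral_tilted_sub_integral_le {μ : Measure α} [IsProbabilityMeasure μ] {h : α → ℝ}
    (hm : Measurable h) {c K : ℝ} (hb : ∀ x, |h x - c| ≤ K) {X : α → ℝ} (hXm : Measurable X) {C : ℝ}
    (hXb : ∀ x, |X x| ≤ C) :
    |(∫ x, X x ∂(μ.tilted h)) - ∫ x, X x ∂μ| ≤ (exp (2 * K) - 1) * sqrt (variance X μ) := by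
  have hlo : ∀ x, c - K ≤ h x := fun x => by linarith [(abs_le.1 (hb x)).1]
  have hhi : ∀ x, h x ≤ c + K := fun x => by linarith [(abs_le.1 (hb x)).2]
  have hint : Integrable (fun x => exp (h x)) μ :=
    Integrable.of_bound hm.exp.aestronglyMeasurable (exp (c + K))
      (ae_of_all _ fun x => by
        rw [Real.norm_eq_abs, abs_of_pos (exp_pos _)]
        exact exp_le_exp.2 (hhi x))
  set Z : ℝ := ∫ x, exp (h x) ∂μ with hZ_def
  have hZlo : exp (c - K) ≤ Z := by
    calc exp (c - K) = ∫ _x, exp (c - K) ∂μ := by simp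
      _ ≤ Z := integral_mono (integrable_const _) hint fun x => exp_le_exp.2 (hlo x)
  have hZhi : Z ≤ exp (c + K) := by
    calc Z ≤ ∫ _x, exp (c + K) ∂μ := integral_mono hint (integrable_const _) fun x => exp_le_exp.2 (hhi x)
      _ = exp (c + K) := by simp
  have hZpos : 0 < Z := (exp_pos _).trans_le hZlo
  -- the density `r = e^h / Z` lies in `[e^{−2K}, e^{2K}]`, so `|r − 1| ≤ e^{2K} − 1`
  set r : α → ℝ := fun x => exp (h x) / Z with hr_def
  have hrm : Measurable r := hm.exp.div_const _
  have hr_hi : ∀ x, r x ≤ exp (2 * K) := fun x => by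
    rw [hr_def]; dsimp only
    rw [div_le_iff₀ hZpos]
    calc exp (h x) ≤ exp (c + K) := exp_le_exp.2 (hhi x)
      _ = exp (2 * K) * exp (c - K) := by rw [← exp_add]; ring_nf
      _ ≤ exp (2 * K) * Z := by gcongr
  have hr_lo : ∀ x, exp (-(2 * K)) ≤ r x := fun x => by
    rw [hr_def]; dsimp only
    rw [le_div_iff₀ hZpos]
    calc exp (-(2 * K)) * Z ≤ exp (-(2 * K)) * exp (c + K) := by gcongr
      _ = exp (c - K) := by rw [← exp_add]; ring_nf
      _ ≤ exp (h x) := exp_le_exp.2 (hlo x)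
  have hcosh : 1 - exp (-(2 * K)) ≤ exp (2 * K) - 1 := by
    have h1 := Real.add_one_le_exp (2 * K)
    have h2 := Real.add_one_le_exp (-(2 * K))
    linarith
  have hr1 : ∀ x, |r x - 1| ≤ exp (2 * K) - 1 := fun x => by
    rw [abs_le]
    constructor <;> linarith [hr_hi x, hr_lo x]
  -- `∫ r dμ = 1`
  have hr_int : ∫ x, r x ∂μ = 1 := by
    rw [hr_def]; dsimp only
    rw [integral_div, div_self hZpos.ne']
  -- rewrite the tilted mean
  set m : ℝ := ∫ x, X x ∂μ with hm_def
  have hXi : Integrable X μ :=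
    Integrable.of_bound hXm.aestronglyMeasurable C (ae_of_all _ fun x => by rw [Real.norm_eq_abs]; exact hXb x)
  have hri : Integrable r μ :=
    Integrable.of_bound hrm.aestronglyMeasurable (exp (2 * K)) (ae_of_all _ fun x => by
      rw [Real.norm_eq_abs, abs_of_nonneg ((exp_pos _).le.trans (hr_lo x))]; exact hr_hi x)
  have hrXi : Integrable (fun x => r x * (X x - m)) μ := by
    refine Integrable.of_bound (hrm.mul (hXm.sub_const m)).aestronglyMeasurable (exp (2 * K) * (C + |m|))
      (ae_of_all _ fun x => ?_)
    rw [Real.norm_eq_abs, abs_mul, abs_of_nonneg ((exp_pos _).le.trans (hr_lo x))]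
    exact mul_le_mul (hr_hi x) ((abs_sub _ _).trans (by linarith [hXb x])) (abs_nonneg _)
      (exp_pos _).le
  have htilt : ∫ x, X x ∂(μ.tilted h) = ∫ x, r x * X x ∂μ := by
    rw [integral_tilted]
    refine integral_congr_ae (ae_of_all _ fun x => ?_)
    show (rexp (h x) / ∫ x, rexp (h x) ∂μ) • X x = r x * X x
    rw [smul_eq_mul]
  have hXm_int : Integrable (fun x => X x - m) μ := hXi.sub (integrable_const m)
  have hmr_int : Integrable (fun x => m * r x) μ := hri.const_mul m
  have hdiff : (∫ x, X x ∂(μ.tilted h)) - m = ∫ x, (r x - 1) * (X x - m) ∂μ := by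
    have e1 : ∫ x, (r x - 1) * (X x - m) ∂μ = ∫ x, (r x * (X x - m) - (X x - m)) ∂μ :=
      integral_congr_ae (ae_of_all _ fun x => by ring)
    have e2 : ∫ x, r x * X x ∂μ = ∫ x, (r x * (X x - m) + m * r x) ∂μ :=
      integral_congr_ae (ae_of_all _ fun x => by ring)
    have e3 : ∫ x, (X x - m) ∂μ = 0 := by
      rw [integral_sub hXi (integrable_const m), integral_const, probReal_univ]
      simp [hm_def]
    rw [htilt, e1, integral_sub hrXi hXm_int, e2, integral_add hrXi hmr_int, integral_const_mul, hr_int, e3]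
    ring
  -- `|∫ (r−1)(X−m)| ≤ (e^{2K}−1) ∫ |X − m| ≤ (e^{2K}−1) √Var`
  have habsi : Integrable (fun x => |X x - m|) μ := (hXi.sub (integrable_const m)).abs
  have hstep : |∫ x, (r x - 1) * (X x - m) ∂μ| ≤ (exp (2 * K) - 1) * ∫ x, |X x - m| ∂μ := by
    rw [← integral_const_mul]
    refine (abs_integral_le_integral_abs).trans (integral_mono_of_nonneg (ae_of_all _ fun x => abs_nonneg _)
      (habsi.const_mul _) (ae_of_all _ fun x => ?_))
    simp only
    rw [abs_mul]
    exact mul_le_mul_of_nonneg_right (hr1 x) (abs_nonneg _)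
  have hsq : (∫ x, |X x - m| ∂μ) ^ 2 ≤ variance X μ := by
    rw [variance_eq_integral hXm.aemeasurable]
    exact sq_integral_abs_le_integral_sq (hXm.sub_const m) (C := C + |m|) fun x =>
      (abs_sub (X x) m).trans (by linarith [hXb x])
  have hsqrt : ∫ x, |X x - m| ∂μ ≤ sqrt (variance X μ) :=
    Real.le_sqrt_of_sq_le hsq
  have hK : 0 ≤ exp (2 * K) - 1 := by
    have := abs_nonneg (r (Classical.choice (nonempty_of_isProbabilityMeasure μ)) - 1)
    linarith [hr1 (Classical.choice (nonempty_of_isProbabilityMeasure μ))]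
  rw [hdiff]
  exact hstep.trans (mul_le_mul_of_nonneg_left hsqrt hK)

end Tilted

/-! ## §2 The two-dimensional mean action -/

section TwoDim

variable {L N : ℕ} [NeZero L] {G : Type*} [Group G] [TopologicalSpace G] [IsTopologicalGroup G]
  [CompactSpace G] [MeasurableSpace G] [BorelSpace G] [SecondCountableTopology G]
  (ρ : G →* Matrix (Fin N) (Fin N) ℂ)

/-- **The punctured mean**: `E_{ν_β}[S'] = #\{x ≠ x₀\}·∫ s dπ_β` — the off-puncture plaquettes are identically
distributed with the one-plaquette tilted Haar law. [ours] -/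
theorem integral_punctured_eq (hL : 2 ≤ L) (hρ : Continuous ρ) (x₀ : Site 2 L) (β : ℝ) :
    ∫ U, (∑ i : {x : Site 2 L // x ≠ x₀}, ((N : ℝ) - (ρ (plaquetteHolonomy U i.1 0 1)).trace.re))
      ∂((trivialMeasure G 2 L).tilted fun U => ∑ i : {x : Site 2 L // x ≠ x₀},
        -(β * ((N : ℝ) - (ρ (plaquetteHolonomy U i.1 0 1)).trace.re))) =
      (Fintype.card {x : Site 2 L // x ≠ x₀} : ℝ) *
        ∫ g, ((N : ℝ) - (ρ g).trace.re) ∂((haarProbability G).tilted fun g => -(β * ((N : ℝ) - (ρ g).trace.re))) := by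
  classical
  set s : G → ℝ := fun g => (N : ℝ) - (ρ g).trace.re with hs_def
  set π₁ : Measure G := (haarProbability G).tilted fun g => -(β * s g) with hπ₁
  have hs_cont : Continuous s := continuous_plaqTerm ρ hρ
  haveI : IsProbabilityMeasure π₁ := isProbabilityMeasure_tilted
    (integrable_of_continuous_compactSpace (haarProbability G)
      (continuous_exp.comp (continuous_const.mul hs_cont).neg))
  let Φ : GaugeConfig 2 L G → ({x : Site 2 L // x ≠ x₀} → G) := fun U i => plaquetteHolonomy U i.1 0 1
  have hΦ : Measurable Φ := measurable_pi_lambda _ fun i => measurable_plaquetteHolonomy i.1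
  have hT : Continuous fun ω : {x : Site 2 L // x ≠ x₀} → G => ∑ i, s (ω i) :=
    continuous_finsetSum _ fun i _ => hs_cont.comp (continuous_apply i)
  -- transport to the push-forward, which is the product measure
  have h1 : ∫ U, (∑ i : {x : Site 2 L // x ≠ x₀}, s (plaquetteHolonomy U i.1 0 1))
      ∂((trivialMeasure G 2 L).tilted fun U => ∑ i : {x : Site 2 L // x ≠ x₀},
        -(β * s (plaquetteHolonomy U i.1 0 1))) =
      ∫ ω, (∑ i : {x : Site 2 L // x ≠ x₀}, s (ω i)) ∂(Measure.pi fun _ : {x : Site 2 L // x ≠ x₀} => π₁) := by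
    rw [← map_punctured_eq_pi ρ hL hρ x₀ β, integral_map hΦ.aemeasurable hT.aestronglyMeasurable]
  have hint_i : ∀ i : {x : Site 2 L // x ≠ x₀},
      Integrable (fun ω : {x : Site 2 L // x ≠ x₀} → G => s (ω i))
        (Measure.pi fun _ : {x : Site 2 L // x ≠ x₀} => π₁) := fun i =>
    integrable_of_continuous_compactSpace _ (hs_cont.comp (continuous_apply i))
  rw [h1, integral_finsetSum _ fun i _ => hint_i i]
  have h2 : ∀ i : {x : Site 2 L // x ≠ x₀},
      ∫ ω, s (ω i) ∂(Measure.pi fun _ : {x : Site 2 L // x ≠ x₀} => π₁) = ∫ g, s g ∂π₁ := by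
    intro i
    have h := integral_map (μ := Measure.pi fun _ : {x : Site 2 L // x ≠ x₀} => π₁)
      (measurable_pi_apply i).aemeasurable (hs_cont.aestronglyMeasurable (μ := Measure.map (fun ω => ω i)
        (Measure.pi fun _ : {x : Site 2 L // x ≠ x₀} => π₁)))
    rw [(measurePreserving_eval (fun _ : {x : Site 2 L // x ≠ x₀} => π₁) i).map_eq] at h
    exact h.symm
  simp_rw [h2]
  rw [Finset.sum_const, Finset.card_univ, nsmul_eq_mul]

/-- **MAIN THEOREM — THE TWO-DIMENSIONAL MEAN ACTION IS THE ONE-PLAQUETTE VALUE UP TO `O(L)`**: on `(ℤ/L)²`,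
`L ≥ 2`, for every continuous representation `ρ` of a compact group and every real `β`,
`|⟨S_W⟩_β − (L² − 1)·∫ s dπ_β| ≤ N·√(L² − 1)·(e^{2N|β|} − 1) + 2N`, `π_β = Haar.tilted(−βs)`, `s = N − Re tr ρ`. [ours] -/
theorem wilson_meanAction_twoDim (hL : 2 ≤ L) (hρ : Continuous ρ) (β : ℝ) :
    |(∫ U, wilsonAction ρ U ∂(wilsonMeasure (d := 2) (L := L) ρ β)) -
        ((L : ℝ) ^ 2 - 1) * ∫ g, ((N : ℝ) - (ρ g).trace.re)
          ∂((haarProbability G).tilted fun g => -(β * ((N : ℝ) - (ρ g).trace.re)))| ≤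
      N * sqrt ((L : ℝ) ^ 2 - 1) * (exp (2 * N * |β|) - 1) + 2 * N := by
  classical
  set s : G → ℝ := fun g => (N : ℝ) - (ρ g).trace.re with hs_def
  have hs_cont : Continuous s := continuous_plaqTerm ρ hρ
  have hs_abs : ∀ g, |s g - N| ≤ N := fun g => by
    have h := plaqTerm_mem_Icc ρ hρ g
    rw [abs_le]; constructor <;> linarith [h.1, h.2]
  let x₀ : Site 2 L := 0
  set S' : GaugeConfig 2 L G → ℝ := fun U => ∑ i : {x : Site 2 L // x ≠ x₀},
      ((N : ℝ) - (ρ (plaquetteHolonomy U i.1 0 1)).trace.re) with hS'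
  set ν : Measure (GaugeConfig 2 L G) := (trivialMeasure G 2 L).tilted fun U =>
      ∑ i : {x : Site 2 L // x ≠ x₀}, -(β * ((N : ℝ) - (ρ (plaquetteHolonomy U i.1 0 1)).trace.re))
    with hν
  have hS'c : Continuous S' :=
    continuous_finsetSum _ fun i _ => (continuous_plaqTerm ρ hρ).comp
      ((continuous_apply i).comp (continuous_holonomies_ne (G := G) x₀))
  have hνc : Continuous fun U : GaugeConfig 2 L G => ∑ i : {x : Site 2 L // x ≠ x₀},
      -(β * ((N : ℝ) - (ρ (plaquetteHolonomy U i.1 0 1)).trace.re)) :=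
    continuous_finsetSum _ fun i _ => (continuous_const.mul ((continuous_plaqTerm ρ hρ).comp
      ((continuous_apply i).comp (continuous_holonomies_ne (G := G) x₀)))).neg
  haveI : IsProbabilityMeasure (trivialMeasure G 2 L) := trivialMeasure_isProbabilityMeasure
  haveI : IsProbabilityMeasure ν :=
    isProbabilityMeasure_tilted (integrable_trivialMeasure_of_continuous_group (continuous_exp.comp hνc))
  haveI := isProbabilityMeasure_wilsonMeasure (d := 2) (L := L) ρ hρ β
  have hhol₀c : Continuous fun U : GaugeConfig 2 L G => plaquetteHolonomy U x₀ 0 1 := by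
    unfold plaquetteHolonomy; fun_prop
  have hS'b : ∀ U, |S' U| ≤ Fintype.card {x : Site 2 L // x ≠ x₀} * (2 * N) := by
    intro U
    calc |S' U| ≤ ∑ i : {x : Site 2 L // x ≠ x₀}, |((N : ℝ) - (ρ (plaquetteHolonomy U i.1 0 1)).trace.re)| :=
          Finset.abs_sum_le_sum_abs _ _
      _ ≤ ∑ _i : {x : Site 2 L // x ≠ x₀}, (2 * (N : ℝ)) := Finset.sum_le_sum fun i _ => by
          have h := plaqTerm_mem_Icc ρ hρ (plaquetteHolonomy U i.1 0 1)
          rw [abs_le]; constructor <;> linarith [h.1, h.2]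
      _ = Fintype.card {x : Site 2 L // x ≠ x₀} * (2 * N) := by
          rw [Finset.sum_const, Finset.card_univ, nsmul_eq_mul]
  -- card of the punctured site set
  have hcard : (Fintype.card {x : Site 2 L // x ≠ x₀} : ℝ) = (L : ℝ) ^ 2 - 1 := by
    have h1 : Fintype.card {x : Site 2 L // x ≠ x₀} = Fintype.card (Site 2 L) - 1 := by
      rw [Fintype.card_subtype_compl, Fintype.card_subtype_eq]
    have hS : Fintype.card (Site 2 L) = L ^ 2 := by
      rw [Fintype.card_fun, ZMod.card, Fintype.card_fin]
    have hL1 : 1 ≤ L ^ 2 := Nat.one_le_pow _ _ (by omega)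
    rw [h1, hS, Nat.cast_sub hL1]
    push_cast
    ring
  -- (i) the tilt moves the mean of `S'` by at most `(e^{2N|β|} − 1)·√Var_ν(S')`
  have hK : ∀ U : GaugeConfig 2 L G,
      |-(β * ((N : ℝ) - (ρ (plaquetteHolonomy U x₀ 0 1)).trace.re)) - (-(β * N))| ≤ N * |β| := by
    intro U
    have : -(β * ((N : ℝ) - (ρ (plaquetteHolonomy U x₀ 0 1)).trace.re)) - (-(β * N)) =
        -(β * (s (plaquetteHolonomy U x₀ 0 1) - N)) := by simp only [hs_def]; ring
    rw [this, abs_neg, abs_mul, mul_comm]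
    exact mul_le_mul_of_nonneg_right (hs_abs _) (abs_nonneg β)
  have hmove : |(∫ U, S' U ∂(wilsonMeasure (d := 2) (L := L) ρ β)) - ∫ U, S' U ∂ν| ≤
      (exp (2 * (N * |β|)) - 1) * sqrt (variance S' ν) := by
    rw [wilsonMeasure_two_eq_tilted_punctured ρ hρ x₀ β, ← hν]
    exact abs_integral_tilted_sub_integral_le (μ := ν)
      ((continuous_const.mul ((continuous_plaqTerm ρ hρ).comp hhol₀c)).neg.measurable) hK hS'c.measurable hS'b
  -- (ii) `Var_ν(S') ≤ (L²−1)N²`, `E_ν[S'] = (L²−1)·∫ s dπ_β`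
  have hvar : variance S' ν ≤ ((L : ℝ) ^ 2 - 1) * (N : ℝ) ^ 2 := variance_punctured_le ρ hL hρ x₀ β
  have hmean : ∫ U, S' U ∂ν = ((L : ℝ) ^ 2 - 1) *
      ∫ g, ((N : ℝ) - (ρ g).trace.re) ∂((haarProbability G).tilted fun g => -(β * ((N : ℝ) - (ρ g).trace.re))) := by
    rw [← hcard]
    exact integral_punctured_eq ρ hL hρ x₀ β
  have hsqrt : sqrt (variance S' ν) ≤ N * sqrt ((L : ℝ) ^ 2 - 1) := by
    have hN : (0 : ℝ) ≤ N := Nat.cast_nonneg N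
    calc sqrt (variance S' ν) ≤ sqrt (((L : ℝ) ^ 2 - 1) * (N : ℝ) ^ 2) := Real.sqrt_le_sqrt hvar
      _ = N * sqrt ((L : ℝ) ^ 2 - 1) := by
          rw [Real.sqrt_mul' _ (sq_nonneg _), Real.sqrt_sq hN, mul_comm]
  -- (iii) `⟨S_W⟩ = ⟨S'⟩ + ⟨s(U_{x₀})⟩` with the last term in `[0, 2N]`
  have hS_int : Integrable (wilsonAction (d := 2) (L := L) ρ) (wilsonMeasure (d := 2) (L := L) ρ β) :=
    integrable_of_continuous_compactSpace _ (continuous_wilsonAction_of_continuous ρ hρ)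
  have hS'_int : Integrable S' (wilsonMeasure (d := 2) (L := L) ρ β) :=
    integrable_of_continuous_compactSpace _ hS'c
  have h0_int : Integrable (fun U => s (plaquetteHolonomy U x₀ 0 1)) (wilsonMeasure (d := 2) (L := L) ρ β) :=
    integrable_of_continuous_compactSpace _ (hs_cont.comp hhol₀c)
  have hsplit : ∫ U, wilsonAction ρ U ∂(wilsonMeasure (d := 2) (L := L) ρ β) =
      (∫ U, S' U ∂(wilsonMeasure (d := 2) (L := L) ρ β)) +
        ∫ U, s (plaquetteHolonomy U x₀ 0 1) ∂(wilsonMeasure (d := 2) (L := L) ρ β) := by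
    rw [← integral_add hS'_int h0_int]
    refine integral_congr_ae (ae_of_all _ fun U => ?_)
    rw [wilsonAction_two_eq_add_sum_ne ρ x₀ U]
    simp only [hS', hs_def]
    ring
  have h0lo : 0 ≤ ∫ U, s (plaquetteHolonomy U x₀ 0 1) ∂(wilsonMeasure (d := 2) (L := L) ρ β) :=
    integral_nonneg fun U => (plaqTerm_mem_Icc ρ hρ _).1
  have h0hi : ∫ U, s (plaquetteHolonomy U x₀ 0 1) ∂(wilsonMeasure (d := 2) (L := L) ρ β) ≤ 2 * N := by
    calc ∫ U, s (plaquetteHolonomy U x₀ 0 1) ∂(wilsonMeasure (d := 2) (L := L) ρ β)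
        ≤ ∫ _U, (2 * N : ℝ) ∂(wilsonMeasure (d := 2) (L := L) ρ β) :=
          integral_mono h0_int (integrable_const _) fun U => (plaqTerm_mem_Icc ρ hρ _).2
      _ = 2 * N := by simp
  -- assemble
  have hexp : 0 ≤ exp (2 * (N * |β|)) - 1 := by linarith [one_le_exp (show 0 ≤ 2 * (N * |β|) by positivity)]
  have hmove' : |(∫ U, S' U ∂(wilsonMeasure (d := 2) (L := L) ρ β)) - ∫ U, S' U ∂ν| ≤
      N * sqrt ((L : ℝ) ^ 2 - 1) * (exp (2 * N * |β|) - 1) := by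
    rw [show 2 * (N : ℝ) * |β| = 2 * (N * |β|) by ring]
    calc _ ≤ (exp (2 * (N * |β|)) - 1) * sqrt (variance S' ν) := hmove
      _ ≤ (exp (2 * (N * |β|)) - 1) * (N * sqrt ((L : ℝ) ^ 2 - 1)) := mul_le_mul_of_nonneg_left hsqrt hexp
      _ = N * sqrt ((L : ℝ) ^ 2 - 1) * (exp (2 * (N * |β|)) - 1) := by ring
  rw [hsplit, ← hmean]
  have habs := abs_le.1 hmove'
  rw [abs_le]
  constructor <;> linarith [habs.1, habs.2]

end TwoDim

end Summit.Ventures.LatticeQCDFlow.TrivializingMaps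

end
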